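import Summits.BirchSwinnertonDyer.BirchSwinnertonDyer.Theorems.SignedLowerHalvesSmallImageLowerHalfBothSignsRttCharRoadE1QuadraticDescent
import Summits.BirchSwinnertonDyer.BirchSwinnertonDyer.Theorems.SignedLowerHalvesSmallImageLowerHalfBothSignsRttCharRoadE1EigenDecomposition
import HarnessLib

/-!
# Route `SignedLowerHalves`, crux L `SmallImageLowerHalfBothSigns` (stmt-BirchSwinnertonDyer-23599), line `rtt_w3` v10′ — brick D1′ of COUNT_π / INJ
# (memo `Lines/rtt_w3-MEMO-D3c-w3g17.md` §5, the «cores route»): QUADRATIC DESCENT BY CORESTRICTION WITH A SEMILINEAR TWIST —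
# `ξ ↦ (cor ξ, cor (u_* ξ))` is INJECTIVE `H¹(N, M) → H¹(G, M)²` for an `N`-equivariant `u` ANTI-commuting with `c` and having an
# `N`-equivariant left inverse, `M` killed by an odd prime.

Width seat `bsd-line-slh-p3-w3` g17 under LEAD `cruxlead-stmt-BirchSwinnertonDyer-23599` (cell `bsd-ssimc`; `--supports stmt-BirchSwinnertonDyer-23599 --as helper`).
THEOREMS ONLY (no definition, no named fact, no instance, no `sorry`); generic continuous group cohomology in the currency of brick D1
(`…RttCharRoadE1QuadraticDescent`, p763571) and of the LEAD's `pushH1` calculus (`…RttCharRoadE1EigenDecomposition`, p763850: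
`(e)_* = resH1Hom id e`, `conjH1_pushH1`) on top of the tree's index-`2` transfer `corH1` (`Literature/…/H1CorestrictionIndexTwo`:
`res ∘ cor = 1 + c_*`). BSD / crux L / COUNT / INJ are NOT proved here.

WHY (INJ needs `N = f = [k_S : 𝔽_p]` W-side classes per θ-side class). Without building the `Γ_ℚ`-module `W[p^∞] ⊗ 𝒪` (the idempotent route, D2),
one gets `f` classes over `ℚ_n` from the `f/2` local `𝒪_{K_v}`-coordinates `M_θ[π] = k_S(θ̄) ≅ W[p]^{f/2}` (Γ_K-equivariantly) and, PER COORDINATE,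
the TWO corestrictions `cor ξ`, `cor([u]_* ξ)` where `u = [√d]` is the formal `𝒪_{K_v}`-multiplication on `W[p^∞]` (`Γ_K`-linear, `c∘u = −u∘c`
for the complex conjugation / Frobenius `c`). This file proves the injectivity of that pair; the local conditions of `cor ξ` are read through
`res (cor ξ) = ξ + c_* ξ` (D3-a p764060, D3-W p765485, B5-pts p765177 for the `[u]`-stability).

* `pushH1_neg_apply` — `(−e)_* = −(e)_*`.
* ★ `eq_zero_of_corH1_eq_zero_of_corH1_pushH1_eq_zero` — `cor ξ = 0 ∧ cor (u_* ξ) = 0 ⇒ ξ = 0`: restricting, `ξ + c_*ξ = 0` and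
  `u_*ξ + c_* u_* ξ = u_*(ξ − c_*ξ) = 0` (`c_* u_* = (−u)_* c_*`), so `ξ − c_* ξ = 0` (left inverse `v`), `2ξ = 0`, `ξ = 0` (`p` odd).
* ★★ `injective_corH1_prod_corH1_pushH1` — the map `ξ ↦ (cor ξ, cor (u_* ξ))` is injective on `H¹(N, M)`.

References: [SerreGaloisCohomology1997] I §2.4 (res, cor), I §5.8; [NeukirchSchmidtWingberg2008] (1.5.x); [Rubin1991] §4 (motivation).
-/

set_option autoImplicit false
set_option linter.dupNamespace false -- D-0017: single-problem summit, the namespace repeats the problem name by design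
noncomputable section

open scoped Classical

universe u

namespace Summit.BirchSwinnertonDyer.BirchSwinnertonDyer.Theorems.SmallImageCharSignedSelmer

open Literature.NumberTheory.EllipticCurves Literature.NumberTheory.GaloisRepresentations

variable {G : Type u} [Group G] [TopologicalSpace G] [IsTopologicalGroup G] {N : Subgroup G} [N.Normal] {c : G}
  {M : Type u} [AddCommGroup M] [DistribMulAction G M] [TopologicalSpace M] [DiscreteTopology M]

omit [N.Normal] in
/-- `(−e)_* ξ = −(e)_* ξ` (pointwise on cocycles). [cite: SerreGaloisCohomology1997, I §2.4] -/
theorem pushH1_neg_apply (e : M →+ M) (he : ∀ (x : N) (m : M), e (x • m) = x • e m)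
    (hne : ∀ (x : N) (m : M), (-e) (x • m) = x • (-e) m) (ξ : subgroupH1 N M) :
    resH1Hom (ContinuousMonoidHom.id N) (-e) hne ξ = -resH1Hom (ContinuousMonoidHom.id N) e he ξ := by
  obtain ⟨f, rfl⟩ := oneCocycleClass_surjective _ ξ
  obtain ⟨g₁, hg₁, hg₁v⟩ := pushH1_oneCocycleClass e he f
  obtain ⟨g₂, hg₂, hg₂v⟩ := pushH1_oneCocycleClass (-e) hne f
  rw [hg₁, hg₂, ← oneCocycleClassₗ_apply, ← oneCocycleClassₗ_apply, ← map_neg]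
  congr 1
  apply Subtype.ext; ext x
  rw [hg₂v, AddMonoidHom.neg_apply, Submodule.coe_neg, ContinuousMap.neg_apply, hg₁v]

/-- ★ **`cor ξ = 0` and `cor (u_* ξ) = 0` force `ξ = 0`**, for `N ≤ G` open normal of index `2` (`G = N ⊔ Nc`), `M` a discrete `G`-module with
continuous orbit maps killed by an odd prime `p`, and `u : M → M` additive, `N`-equivariant, ANTI-commuting with `c` (`u(c•m) = −c•u(m)`) with an
`N`-equivariant left inverse `v`. Restricting (`res ∘ cor = 1 + c_*`): `ξ + c_*ξ = 0` and `u_*ξ + c_*(u_*ξ) = u_*ξ − u_*(c_*ξ) = 0`, hence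
`ξ − c_*ξ = 0` (apply `v_*`), `2ξ = 0`, and `ξ = 0` since `pξ = 0`. [cite: SerreGaloisCohomology1997, I §2.4] [cite: NeukirchSchmidtWingberg2008, (1.5.7)] -/
theorem eq_zero_of_corH1_eq_zero_of_corH1_pushH1_eq_zero (hN : IsOpen (N : Set G)) (hM : ∀ m : M, Continuous fun g : G ↦ g • m)
    (hc : ∀ b : G, Xor (b * c⁻¹ ∈ N) (b ∈ N)) {p : ℕ} (hp : p.Prime) (hp2 : p ≠ 2) (hpM : ∀ a : M, p • a = 0)
    (u v : M →+ M) (hu : ∀ (x : N) (m : M), u (x • m) = x • u m) (hv : ∀ (x : N) (m : M), v (x • m) = x • v m)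
    (hcu : ∀ m : M, u (c • m) = -(c • u m)) (hvu : ∀ m : M, v (u m) = m)
    (ξ : subgroupH1 N M) (h1 : corH1 hN hM hc ξ = 0) (h2 : corH1 hN hM hc (resH1Hom (ContinuousMonoidHom.id N) u hu ξ) = 0) : ξ = 0 := by
  have hne : ∀ (x : N) (m : M), (-u) (x • m) = x • (-u) m := fun x m ↦ by
    rw [AddMonoidHom.neg_apply, AddMonoidHom.neg_apply, hu, smul_neg]
  -- restrict both identities to `N`
  have e1 : ξ + conjH1 N M c ξ = 0 := by
    rw [← resSubgroupH1_corH1 hN hM hc ξ, h1, map_zero]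
  have e2 : resH1Hom (ContinuousMonoidHom.id N) u hu ξ + conjH1 N M c (resH1Hom (ContinuousMonoidHom.id N) u hu ξ) = 0 := by
    rw [← resSubgroupH1_corH1 hN hM hc, h2, map_zero]
  -- `c_* u_* = (−u)_* c_* = −u_* c_*`
  rw [conjH1_pushH1 c u (-u) hu hne (fun m ↦ by rw [AddMonoidHom.neg_apply, hcu, neg_neg]), pushH1_neg_apply u hu hne,
    ← sub_eq_add_neg, ← map_sub] at e2
  -- apply the left inverse `v`
  have hvc : ∀ (x : N) (m : M), (v.comp u) (x • m) = x • (v.comp u) m := fun x m ↦ by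
    rw [AddMonoidHom.comp_apply, AddMonoidHom.comp_apply, hu, hv]
  have hid : ∀ (x : N) (m : M), (AddMonoidHom.id M) (x • m) = x • (AddMonoidHom.id M) m := fun _ _ ↦ rfl
  have e3 : ξ - conjH1 N M c ξ = 0 := by
    have h := congrArg (resH1Hom (ContinuousMonoidHom.id N) v hv) e2
    rw [map_zero, pushH1_comp_apply u v hu hv hvc, resH1Hom_congr rfl (AddMonoidHom.ext hvu : v.comp u = AddMonoidHom.id M) hvc hid,
      pushH1_id_apply] at h
    exact h
  -- `2ξ = 0` and `pξ = 0`
  have h2ξ : 2 • ξ = 0 := by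
    have h := congrArg₂ (· + ·) e1 e3
    simp only [add_zero] at h
    rw [two_nsmul, ← h]
    abel
  exact eq_zero_of_two_nsmul_of_odd_nsmul (hp.odd_of_ne_two hp2) h2ξ (nsmul_eq_zero_of_forall_smul_eq_zero hpM ξ)

/-- ★★ **Injectivity of `ξ ↦ (cor ξ, cor (u_* ξ))` on `H¹(N, M)`** (same hypotheses). In INJ: `G = Γ_{ℚ_n}`, `N = Γ_{K_n}`, `M = W[p]`,
`u = [√d]` the formal `𝒪_{K_v}`-multiplication (Γ_K-linear, anti-commuting with a Frobenius `c` of the inert `p`), `v = d⁻¹•u`; each θ-side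
coordinate class gives TWO classes over `ℚ_n`, `f/2 · 2 = f = [k_S : 𝔽_p]` in all. [cite: SerreGaloisCohomology1997, I §2.4] -/
theorem injective_corH1_prod_corH1_pushH1 (hN : IsOpen (N : Set G)) (hM : ∀ m : M, Continuous fun g : G ↦ g • m)
    (hc : ∀ b : G, Xor (b * c⁻¹ ∈ N) (b ∈ N)) {p : ℕ} (hp : p.Prime) (hp2 : p ≠ 2) (hpM : ∀ a : M, p • a = 0)
    (u v : M →+ M) (hu : ∀ (x : N) (m : M), u (x • m) = x • u m) (hv : ∀ (x : N) (m : M), v (x • m) = x • v m)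
    (hcu : ∀ m : M, u (c • m) = -(c • u m)) (hvu : ∀ m : M, v (u m) = m) :
    Function.Injective fun ξ : subgroupH1 N M ↦
      (corH1 hN hM hc ξ, corH1 hN hM hc (resH1Hom (ContinuousMonoidHom.id N) u hu ξ)) := by
  intro ξ₁ ξ₂ h
  simp only [Prod.mk.injEq] at h
  rw [← sub_eq_zero]
  refine eq_zero_of_corH1_eq_zero_of_corH1_pushH1_eq_zero hN hM hc hp hp2 hpM u v hu hv hcu hvu _ ?_ ?_
  · rw [map_sub, h.1, sub_self]
  · rw [map_sub, map_sub, h.2, sub_self]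

/-- ★ **`p`-torsion CLASS version** (coefficients `M = E[p^∞]`, not killed by `p`): same hypotheses on `N ≤ G`, `c`, `u`, `v`, but only the
CLASS `ξ` is assumed killed by `p` (`p • ξ = 0`); then `cor ξ = 0 ∧ cor (u_* ξ) = 0 ⇒ ξ = 0` (restrict: `ξ + c_*ξ = 0`, `u_*(ξ − c_*ξ) = 0`, apply
`v_*`, `2ξ = 0 = pξ`, `p` odd). This is the form INJ consumes (`W`-side group = the `p`-torsion of a Selmer group with `E[p^∞]`-coefficients).
[cite: SerreGaloisCohomology1997, I §2.4] [cite: NeukirchSchmidtWingberg2008, (1.5.7)] -/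
theorem eq_zero_of_corH1_eq_zero_of_corH1_pushH1_eq_zero_of_nsmul_eq_zero (hN : IsOpen (N : Set G))
    (hM : ∀ m : M, Continuous fun g : G ↦ g • m) (hc : ∀ b : G, Xor (b * c⁻¹ ∈ N) (b ∈ N)) {p : ℕ} (hp : p.Prime) (hp2 : p ≠ 2)
    (u v : M →+ M) (hu : ∀ (x : N) (m : M), u (x • m) = x • u m) (hv : ∀ (x : N) (m : M), v (x • m) = x • v m)
    (hcu : ∀ m : M, u (c • m) = -(c • u m)) (hvu : ∀ m : M, v (u m) = m)
    (ξ : subgroupH1 N M) (hξ : p • ξ = 0) (h1 : corH1 hN hM hc ξ = 0)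
    (h2 : corH1 hN hM hc (resH1Hom (ContinuousMonoidHom.id N) u hu ξ) = 0) : ξ = 0 := by
  have hne : ∀ (x : N) (m : M), (-u) (x • m) = x • (-u) m := fun x m ↦ by
    rw [AddMonoidHom.neg_apply, AddMonoidHom.neg_apply, hu, smul_neg]
  -- restrict both identities to `N`
  have e1 : ξ + conjH1 N M c ξ = 0 := by
    rw [← resSubgroupH1_corH1 hN hM hc ξ, h1, map_zero]
  have e2 : resH1Hom (ContinuousMonoidHom.id N) u hu ξ + conjH1 N M c (resH1Hom (ContinuousMonoidHom.id N) u hu ξ) = 0 := by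
    rw [← resSubgroupH1_corH1 hN hM hc, h2, map_zero]
  rw [conjH1_pushH1 c u (-u) hu hne (fun m ↦ by rw [AddMonoidHom.neg_apply, hcu, neg_neg]), pushH1_neg_apply u hu hne,
    ← sub_eq_add_neg, ← map_sub] at e2
  have hvc : ∀ (x : N) (m : M), (v.comp u) (x • m) = x • (v.comp u) m := fun x m ↦ by
    rw [AddMonoidHom.comp_apply, AddMonoidHom.comp_apply, hu, hv]
  have hid : ∀ (x : N) (m : M), (AddMonoidHom.id M) (x • m) = x • (AddMonoidHom.id M) m := fun _ _ ↦ rfl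
  have e3 : ξ - conjH1 N M c ξ = 0 := by
    have h := congrArg (resH1Hom (ContinuousMonoidHom.id N) v hv) e2
    rw [map_zero, pushH1_comp_apply u v hu hv hvc, resH1Hom_congr rfl (AddMonoidHom.ext hvu : v.comp u = AddMonoidHom.id M) hvc hid,
      pushH1_id_apply] at h
    exact h
  have h2ξ : 2 • ξ = 0 := by
    have h := congrArg₂ (· + ·) e1 e3
    simp only [add_zero] at h
    rw [two_nsmul, ← h]
    abel
  exact eq_zero_of_two_nsmul_of_odd_nsmul (hp.odd_of_ne_two hp2) h2ξ hξ

/-- ★★ **Injectivity of `ξ ↦ (cor ξ, cor (u_* ξ))` on the `p`-TORSION of `H¹(N, M)`** (class version; `M` arbitrary, e.g. `E[p^∞]`): two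
`p`-torsion classes with the same pair of corestrictions are equal. [cite: SerreGaloisCohomology1997, I §2.4] -/
theorem injOn_corH1_prod_corH1_pushH1_nsmul_eq_zero (hN : IsOpen (N : Set G)) (hM : ∀ m : M, Continuous fun g : G ↦ g • m)
    (hc : ∀ b : G, Xor (b * c⁻¹ ∈ N) (b ∈ N)) {p : ℕ} (hp : p.Prime) (hp2 : p ≠ 2)
    (u v : M →+ M) (hu : ∀ (x : N) (m : M), u (x • m) = x • u m) (hv : ∀ (x : N) (m : M), v (x • m) = x • v m)
    (hcu : ∀ m : M, u (c • m) = -(c • u m)) (hvu : ∀ m : M, v (u m) = m) :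
    Set.InjOn (fun ξ : subgroupH1 N M ↦ (corH1 hN hM hc ξ, corH1 hN hM hc (resH1Hom (ContinuousMonoidHom.id N) u hu ξ)))
      {ξ : subgroupH1 N M | p • ξ = 0} := by
  intro ξ₁ hξ₁ ξ₂ hξ₂ h
  simp only [Prod.mk.injEq] at h
  rw [← sub_eq_zero]
  refine eq_zero_of_corH1_eq_zero_of_corH1_pushH1_eq_zero_of_nsmul_eq_zero hN hM hc hp hp2 u v hu hv hcu hvu _ ?_ ?_ ?_
  · rw [nsmul_sub, (hξ₁ : p • ξ₁ = 0), (hξ₂ : p • ξ₂ = 0), sub_self]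
  · rw [map_sub, h.1, sub_self]
  · rw [map_sub, map_sub, h.2, sub_self]

end Summit.BirchSwinnertonDyer.BirchSwinnertonDyer.Theorems.SmallImageCharSignedSelmer

end
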